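import Literature.Barriers.QuantumAdvantage.PBlockedSimBits
import Literature.Barriers.QuantumAdvantage.BoundedEntanglementConjugateBound
import HarnessLib

/-!
# The `p`-blocked simulator: registers as bit lists, and the ideal tables

Topic `Literature/Barriers/QuantumAdvantage`; machine half of the proof programme for
`Literature.Barriers.QuantumAdvantage.jozsaLinden2003_pblocked` (Jozsa–Linden 2003, §3, lemma `ratpbl`).
The program `PBlockedSim.lean` manipulates `N`-bit lists; the quantum half speaks of registers
`QReg N = Fin N → Bool`, wire sets `Finset (Fin N)` and the configuration sets `cfg S`
(`BoundedEntanglementConfigs.lean`). `PBlockedSimBits.lean` reads lists as registers (`toReg`,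
`maskSet`); this file adds the converse direction of the dictionary and then shows that every table
operation of the program, applied to the *ideal table* of a wire set, returns the ideal table that the
update identities of `BoundedEntanglementGramZUpdate.lean` prescribe.

Part 1 (dictionary, registers ↦ lists):
* `ofReg y` (the bit list of a register), `maskOf S` (of a wire set); lengths, injectivity,
  `getD_ofReg`, `toReg_ofReg`, `ofReg_toReg`;
* the bitwise operations on images: `band_ofReg`, `bor_ofReg`, `bandnot_ofReg`, `bor_maskOf`
  (`= maskOf (S ∪ T)`), `band_maskOf`, `bandnot_maskOf`, `zeros_eq_maskOf_empty`, `oneHot_eq_maskOf`,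
  `band_ofReg_maskOf` (`= ofReg (proj S y)`), **`pw_maskOf`** (`= ofReg (S.piecewise u v)`),
  `getD_maskOf`, `popcount_maskOf` (`= S.card`), `setAt_ofReg` (`= ofReg (Function.update y i a)`),
  `maskSet_ofReg`, `maskOf_maskSet`;
* **`subCfgs` of a wire set**: `mem_subCfgs_maskOf_iff : u ∈ subCfgs p (maskOf S) ↔ ∃ y ∈ cfg S, u = ofReg y`
  (for `|S| ≤ 2p`) and the sum bridge **`sum_map_subCfgs_maskOf`**:
  `((subCfgs p (maskOf S)).map f).sum = ∑ y ∈ cfg S, f (ofReg y)`;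
* tables: `lookup_eq_of_forall`, **`lookup_mkTab`** (`= f u v` for listed keys), `mkTab_congr`,
  `doubleTab_mkTab`, `mem_mkTab_iff`, `capZ_eq_self`.

Part 2 (ideal tables `tabOf p B c` = `mkTab` over `subCfgs p (maskOf B)` of the integral Gram data
`gramZ B c`, `c = ampZ F x j`; the saturation `capZ W` is inert as soon as `hExp + 2 ≤ W`,
`natAbs_gramZ_ampZ_le` of `BoundedEntanglementConjugateBound.lean`):
* `tabOf`, `lookup_tabOf`, `lookup_tabOf_proj`, `capZ_gramZ_ampZ`;
* **merge** `mergeTab_tabOf` (`= tabOf p (B₁ ∪ B₂) (ampZ j)`, by `gramZ_union_ampZ`);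
* **untouched blocks** `tabOf_ampZ_succ_of_disjoint` (doubled at `H`, unchanged otherwise, by
  `gramZ_ampZ_succ_of_disjoint`);
* **the gate** `gateTab_tabOf` (`= tabOf p C (ampZ (j+1))`, by `gramZ_ampZ_succ_of_subset`; the wires of
  the gate enter through `wireIdx`, the symbol through `opNum`, and the local sums over `localCfgs` are
  the sums over `QReg 1` / `QReg 2`, `sum_qreg_one`, `sum_qreg_two`);
* **the column** `firstNonzeroDiag_tabOf` (a configuration of `cfg C` with nonzero diagonal entry,
  `exists_gramZ_self_ne_zero`), **the split test** `splitsTest_tabOf` (`= [Splits ψ' S]` for `S ⊆ C`, by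
  `splits_stateAfter_iff_columnZ`, `columnZ_test_iff_cfg`) and **the partial trace**
  `capZ_traceEntry_tabOf` (`= gramZ A c u v` for `A ⊆ C`, by `gramZ_eq_sum_gramZ`).

## References

* R. Jozsa, N. Linden, *On the role of entanglement in quantum-computational speed-up*, Proc. R. Soc.
  Lond. A 459 (2003) 2011–2032, arXiv:quant-ph/0201143: §3, proof of lemma `ratpbl` ((a) block
  locations, (b) block states; Cases 1 and 2), lemma `ratlemma`.
-/

noncomputable section

namespace Literature.Barriers.QuantumAdvantage

namespace PSim

open Finset Literature.Computability.Cryptography Literature.Computability.QuantumComplexity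

variable {N : ℕ}

/-! ### Registers and wire sets as bit lists -/

/-- The bit list of a register. [folklore] -/
def ofReg (y : QReg N) : Cfg := List.ofFn y

/-- The bit list (mask) of a wire set. [folklore] -/
def maskOf (S : Finset (Fin N)) : Cfg := ofReg fun i => decide (i ∈ S)

/-- `|ofReg y| = N`. [folklore] -/
@[simp] theorem length_ofReg (y : QReg N) : (ofReg y).length = N := List.length_ofFn

/-- `|maskOf S| = N`. [folklore] -/
@[simp] theorem length_maskOf (S : Finset (Fin N)) : (maskOf S).length = N := length_ofReg _

/-- `ofReg` is injective. [folklore] -/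
theorem ofReg_injective : Function.Injective (ofReg : QReg N → Cfg) := List.ofFn_injective

/-- `maskOf` is injective. [folklore] -/
theorem maskOf_injective : Function.Injective (maskOf : Finset (Fin N) → Cfg) := by
  intro S T h
  have h' := ofReg_injective h
  ext i
  simpa using congrFun h' i

/-- The bits of `ofReg y`. [folklore] -/
theorem getD_ofReg (y : QReg N) (i : ℕ) : (ofReg y).getD i false = if h : i < N then y ⟨i, h⟩ else false := by
  rw [List.getD_eq_getElem?_getD]
  split_ifs with h
  · rw [List.getElem?_eq_getElem (by simpa [ofReg] using h)]
    simp [ofReg]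
  · rw [List.getElem?_eq_none (by simpa [ofReg] using Nat.le_of_not_lt h)]
    rfl

/-- The bits of `ofReg y` at a wire. [folklore] -/
@[simp] theorem getD_ofReg_fin (y : QReg N) (i : Fin N) : (ofReg y).getD i false = y i := by
  rw [getD_ofReg, dif_pos i.isLt]

/-- The bits of a mask at a wire. [folklore] -/
@[simp] theorem getD_maskOf_fin (S : Finset (Fin N)) (i : Fin N) : (maskOf S).getD i false = decide (i ∈ S) :=
  getD_ofReg_fin _ i

/-- The bits of a mask. [folklore] -/
theorem getD_maskOf (S : Finset (Fin N)) (i : ℕ) :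
    (maskOf S).getD i false = if h : i < N then decide (⟨i, h⟩ ∈ S) else false :=
  getD_ofReg _ i

/-- `toReg ∘ ofReg = id`. [folklore] -/
@[simp] theorem toReg_ofReg (y : QReg N) : toReg N (ofReg y) = y :=
  toReg_ofFn y

/-- `ofReg ∘ toReg = id` on lists of length `N`. [folklore] -/
theorem ofReg_toReg {u : Cfg} (hu : u.length = N) : ofReg (toReg N u) = u := by
  apply List.ext_getElem (by simp [hu])
  intro i h₁ h₂
  simp only [ofReg, List.getElem_ofFn, toReg, List.getD_eq_getElem?_getD, List.getElem?_eq_getElem h₂, Option.getD_some]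

/-- A list of length `N` is `ofReg` of a register. [folklore] -/
theorem exists_eq_ofReg {u : Cfg} (hu : u.length = N) : ∃ y : QReg N, u = ofReg y :=
  ⟨toReg N u, (ofReg_toReg hu).symm⟩

/-! ### Bitwise operations -/

/-- `zipWith` of two `ofReg`s. [folklore] -/
theorem zipWith_ofReg (f : Bool → Bool → Bool) (a b : QReg N) :
    List.zipWith f (ofReg a) (ofReg b) = ofReg fun i => f (a i) (b i) := by
  apply List.ext_getElem (by simp)
  intro i h₁ h₂
  simp [ofReg, List.getElem_zipWith]

/-- `band` of registers. [folklore] -/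
@[simp] theorem band_ofReg (a b : QReg N) : band (ofReg a) (ofReg b) = ofReg fun i => a i && b i :=
  zipWith_ofReg _ a b

/-- `bor` of registers. [folklore] -/
@[simp] theorem bor_ofReg (a b : QReg N) : bor (ofReg a) (ofReg b) = ofReg fun i => a i || b i :=
  zipWith_ofReg _ a b

/-- `bandnot` of registers. [folklore] -/
@[simp] theorem bandnot_ofReg (a b : QReg N) : bandnot (ofReg a) (ofReg b) = ofReg fun i => a i && !b i :=
  zipWith_ofReg _ a b

/-- Union of wire sets. [folklore] -/
@[simp] theorem bor_maskOf (S T : Finset (Fin N)) : bor (maskOf S) (maskOf T) = maskOf (S ∪ T) := by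
  rw [maskOf, maskOf, bor_ofReg]; unfold maskOf; congr 1; funext i; simp [Finset.mem_union]

/-- Intersection of wire sets. [folklore] -/
@[simp] theorem band_maskOf (S T : Finset (Fin N)) : band (maskOf S) (maskOf T) = maskOf (S ∩ T) := by
  rw [maskOf, maskOf, band_ofReg]; unfold maskOf; congr 1; funext i; simp [Finset.mem_inter]

/-- Difference of wire sets. [folklore] -/
@[simp] theorem bandnot_maskOf (S T : Finset (Fin N)) : bandnot (maskOf S) (maskOf T) = maskOf (S \ T) := by
  rw [maskOf, maskOf, bandnot_ofReg]; unfold maskOf; congr 1; funext i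
  simp [Finset.mem_sdiff]

/-- The zero list is the empty mask, and the zero register. [folklore] -/
theorem zeros_eq_maskOf_empty : zeros N = maskOf (∅ : Finset (Fin N)) := by
  apply List.ext_getElem (by simp [zeros])
  intro i h₁ h₂
  simp [zeros, maskOf, ofReg]

/-- The zero list is the zero register. [folklore] -/
theorem zeros_eq_ofReg : zeros N = ofReg (zeroCfg N) := by
  rw [zeros_eq_maskOf_empty, maskOf]; rfl

/-- `oneHot` is the singleton mask. [folklore] -/
theorem oneHot_eq_maskOf (i : Fin N) : oneHot N i = maskOf {i} := by
  apply List.ext_getElem (by simp [oneHot])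
  intro k h₁ h₂
  simp only [oneHot, List.getElem_map, List.getElem_range, maskOf, ofReg, List.getElem_ofFn, Finset.mem_singleton,
    Fin.ext_iff]

/-- Masking a register is the projection `proj`. [folklore] -/
@[simp] theorem band_ofReg_maskOf (y : QReg N) (S : Finset (Fin N)) : band (ofReg y) (maskOf S) = ofReg (proj S y) := by
  rw [maskOf, band_ofReg]; congr 1; funext i
  by_cases hi : i ∈ S
  · simp [hi, proj_apply_of_mem]
  · simp [hi, proj_apply_of_notMem]

/-- Anti-masking a register is the projection onto the complement. [folklore] -/
@[simp] theorem bandnot_ofReg_maskOf (y : QReg N) (S : Finset (Fin N)) :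
    bandnot (ofReg y) (maskOf S) = ofReg (proj Sᶜ y) := by
  rw [maskOf, bandnot_ofReg]; congr 1; funext i
  by_cases hi : i ∈ S
  · simp [hi, proj_apply_of_notMem y (show i ∉ Sᶜ by simpa using hi)]
  · simp [hi, proj_apply_of_mem y (show i ∈ Sᶜ by simpa using hi)]

/-- **Gluing along a mask is `Finset.piecewise`.** [folklore] -/
@[simp] theorem pw_maskOf (S : Finset (Fin N)) (u v : QReg N) : pw (maskOf S) (ofReg u) (ofReg v) = ofReg (S.piecewise u v) := by
  rw [pw, band_ofReg_maskOf, bandnot_ofReg_maskOf, bor_ofReg]; congr 1; funext i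
  by_cases hi : i ∈ S
  · simp [proj_apply_of_mem u hi, proj_apply_of_notMem v (show i ∉ Sᶜ by simpa using hi), hi]
  · simp [proj_apply_of_notMem u hi, proj_apply_of_mem v (show i ∈ Sᶜ by simpa using hi), hi]

/-- `bor` of registers supported in disjoint parts is the gluing. [folklore] -/
theorem bor_ofReg_eq_piecewise {S : Finset (Fin N)} {u t : QReg N} (hu : u ∈ cfg S) (ht : t ∈ cfg Sᶜ) :
    bor (ofReg u) (ofReg t) = ofReg (S.piecewise u t) := by
  rw [bor_ofReg]; congr 1; funext i
  rw [mem_cfg] at hu ht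
  by_cases hi : i ∈ S
  · simp [hi, ht i (by simpa using hi)]
  · simp [hi, hu i hi]

/-- **`popcount (maskOf S) = |S|`.** [folklore] -/
theorem popcount_maskOf (S : Finset (Fin N)) : popcount (maskOf S) = S.card := by
  rw [popcount, maskOf, ofReg, List.ofFn_eq_map, List.count_eq_countP, List.countP_map, List.countP_eq_length_filter]
  have hnd : ((List.finRange N).filter ((fun b => b == true) ∘ fun i => decide (i ∈ S))).Nodup :=
    (List.nodup_finRange N).filter _
  rw [← List.toFinset_card_of_nodup hnd, List.toFinset_filter]
  congr 1
  ext i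
  simp

/-- `setAt` on a register is `Function.update`. [folklore] -/
theorem setAt_ofReg (y : QReg N) (i : Fin N) (a : Bool) : setAt (ofReg y) i a = ofReg (Function.update y i a) := by
  have hset : setAt (ofReg y) i a = (ofReg y).set i a := by
    rw [List.set_eq_take_append_cons_drop, if_pos (by simp), setAt, List.append_assoc, List.singleton_append]
  rw [hset]
  apply List.ext_getElem (by simp)
  intro k h₁ h₂
  simp only [List.getElem_set, ofReg, List.getElem_ofFn]
  by_cases hk : (i : ℕ) = k
  · rw [if_pos hk]
    have : (⟨k, by simpa using h₂⟩ : Fin N) = i := Fin.ext hk.symm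
    rw [this, Function.update_self]
  · rw [if_neg hk, Function.update_of_ne]
    exact fun h => hk (by rw [← h])

/-- The wire set read off the bit list of a register. [folklore] -/
theorem maskSet_ofReg (y : QReg N) : maskSet N (ofReg y) = univ.filter fun i => y i = true := by
  ext i; rw [mem_maskSet, getD_ofReg_fin, mem_filter]; simp

/-- `maskSet ∘ maskOf = id`. [folklore] -/
@[simp] theorem maskSet_maskOf (S : Finset (Fin N)) : maskSet N (maskOf S) = S := by
  ext i; rw [mem_maskSet, getD_maskOf_fin, decide_eq_true_eq]

/-- `maskOf ∘ maskSet = id` on lists of length `N`. [folklore] -/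
theorem maskOf_maskSet {m : Cfg} (hm : m.length = N) : maskOf (maskSet N m) = m := by
  apply List.ext_getElem (by simp [hm])
  intro i h₁ h₂
  simp only [maskOf, ofReg, List.getElem_ofFn, mem_maskSet, List.getD_eq_getElem _ _ h₂, Bool.decide_eq_true]

/-! ### `subCfgs` -/

/-- **`subCfgs` of a wire set lists exactly the registers of `cfg S`.** [cite: JozsaLinden2003, §3 (proof of lemma ratpbl, (b))] -/
theorem mem_subCfgs_maskOf_iff {p : ℕ} {S : Finset (Fin N)} (hS : S.card ≤ 2 * p) {u : Cfg} :
    u ∈ subCfgs p (maskOf S) ↔ ∃ y ∈ cfg S, u = ofReg y := by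
  rw [mem_subCfgs_iff (by rwa [popcount_maskOf]), length_maskOf]
  constructor
  · rintro ⟨hl, hs⟩
    obtain ⟨y, rfl⟩ := exists_eq_ofReg hl
    refine ⟨y, mem_cfg.2 fun i hi => ?_, rfl⟩
    by_contra hne
    have h1 := hs i (by rw [getD_ofReg_fin]; simpa using hne)
    rw [getD_maskOf_fin, decide_eq_true_eq] at h1
    exact hi h1
  · rintro ⟨y, hy, rfl⟩
    refine ⟨length_ofReg y, fun i hi => ?_⟩
    rw [getD_ofReg] at hi
    split_ifs at hi with hlt
    rw [getD_maskOf, dif_pos hlt, decide_eq_true_eq]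
    by_contra hmem
    rw [mem_cfg.1 hy _ hmem] at hi
    exact Bool.false_ne_true hi

/-- `ofReg y ∈ subCfgs p (maskOf S)` for `y ∈ cfg S`. [folklore] -/
theorem ofReg_mem_subCfgs {p : ℕ} {S : Finset (Fin N)} (hS : S.card ≤ 2 * p) {y : QReg N} (hy : y ∈ cfg S) :
    ofReg y ∈ subCfgs p (maskOf S) :=
  (mem_subCfgs_maskOf_iff hS).2 ⟨y, hy, rfl⟩

/-- The finset of `subCfgs` of a wire set is the image of `cfg S`. [folklore] -/
theorem toFinset_subCfgs_maskOf {p : ℕ} {S : Finset (Fin N)} (hS : S.card ≤ 2 * p) :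
    (subCfgs p (maskOf S)).toFinset = (cfg S).image ofReg := by
  ext u
  rw [List.mem_toFinset, mem_subCfgs_maskOf_iff hS, Finset.mem_image]
  constructor
  · rintro ⟨y, hy, rfl⟩; exact ⟨y, hy, rfl⟩
  · rintro ⟨y, hy, rfl⟩; exact ⟨y, hy, rfl⟩

/-- **The sum bridge**: a sum over `subCfgs p (maskOf S)` is the sum over `cfg S`. [folklore] -/
theorem sum_map_subCfgs_maskOf {M : Type*} [AddCommMonoid M] {p : ℕ} {S : Finset (Fin N)} (hS : S.card ≤ 2 * p)
    (f : Cfg → M) : ((subCfgs p (maskOf S)).map f).sum = ∑ y ∈ cfg S, f (ofReg y) := by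
  rw [← List.sum_toFinset f (nodup_subCfgs (by rwa [popcount_maskOf])), toFinset_subCfgs_maskOf hS,
    Finset.sum_image fun _ _ _ _ h => ofReg_injective h]

/-- The length of `subCfgs` of a wire set is `2^{|S|}`. [folklore] -/
theorem length_subCfgs_maskOf {p : ℕ} {S : Finset (Fin N)} (hS : S.card ≤ 2 * p) :
    (subCfgs p (maskOf S)).length = 2 ^ S.card := by
  rw [subCfgs_eq_of_le (by rwa [popcount_maskOf]), List.length_map, List.length_range, popcount_maskOf]

/-! ### Tables -/

/-- **A lookup all of whose matching entries carry one value** returns it, if some entry matches. [folklore] -/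
theorem lookup_eq_of_forall {T : Tab} {key : Cfg × Cfg} {w : ZW} (hall : ∀ e ∈ T, e.1 = key → e.2 = w)
    (hex : ∃ e ∈ T, e.1 = key) : lookup T key = w := by
  rw [lookup]
  suffices h : ∀ (T : Tab) (a : ZW), (∀ e ∈ T, e.1 = key → e.2 = w) →
      T.foldl (fun acc e => if e.1 = key then e.2 else acc) a = if ∃ e ∈ T, e.1 = key then w else a by
    rw [h T 0 hall, if_pos hex]
  intro T
  induction T with
  | nil => intro a _; simp
  | cons e T ih =>
    intro a h
    rw [List.foldl_cons, ih _ fun e' he' => h e' (List.mem_cons_of_mem _ he')]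
    by_cases hT : ∃ e' ∈ T, e'.1 = key
    · rw [if_pos hT, if_pos]
      obtain ⟨e', he', hk⟩ := hT
      exact ⟨e', List.mem_cons_of_mem _ he', hk⟩
    · rw [if_neg hT]
      by_cases he : e.1 = key
      · rw [if_pos he, h e List.mem_cons_self he, if_pos ⟨e, List.mem_cons_self, he⟩]
      · rw [if_neg he, if_neg]
        rintro ⟨e', he', hk⟩
        rcases List.mem_cons.1 he' with rfl | he'
        · exact he hk
        · exact hT ⟨e', he', hk⟩

/-- A lookup with no matching entry is `0`. [folklore] -/
theorem lookup_eq_zero_of_forall_ne {T : Tab} {key : Cfg × Cfg} (h : ∀ e ∈ T, e.1 ≠ key) : lookup T key = 0 := by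
  rw [lookup]
  suffices hs : ∀ (T : Tab) (a : ZW), (∀ e ∈ T, e.1 ≠ key) →
      T.foldl (fun acc e => if e.1 = key then e.2 else acc) a = a from hs T 0 h
  intro T
  induction T with
  | nil => intro a _; rfl
  | cons e T ih =>
    intro a h
    rw [List.foldl_cons, if_neg (h e List.mem_cons_self), ih a fun e' he' => h e' (List.mem_cons_of_mem _ he')]

/-- The entries of `mkTab`. [folklore] -/
theorem mem_mkTab_iff {keys : List Cfg} {f : Cfg → Cfg → ZW} {e : (Cfg × Cfg) × ZW} :
    e ∈ mkTab keys f ↔ ∃ u ∈ keys, ∃ v ∈ keys, e = ((u, v), f u v) := by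
  simp only [mkTab, List.mem_flatten, List.mem_map]
  constructor
  · rintro ⟨row, ⟨u, hu, rfl⟩, he⟩
    obtain ⟨v, hv, rfl⟩ := List.mem_map.1 he
    exact ⟨u, hu, v, hv, rfl⟩
  · rintro ⟨u, hu, v, hv, rfl⟩
    exact ⟨_, ⟨u, hu, rfl⟩, List.mem_map.2 ⟨v, hv, rfl⟩⟩

/-- **Lookup in `mkTab`** at listed keys. [folklore] -/
theorem lookup_mkTab {keys : List Cfg} (f : Cfg → Cfg → ZW) {u v : Cfg} (hu : u ∈ keys) (hv : v ∈ keys) :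
    lookup (mkTab keys f) (u, v) = f u v := by
  refine lookup_eq_of_forall (fun e he hk => ?_) ⟨((u, v), f u v), mem_mkTab_iff.2 ⟨u, hu, v, hv, rfl⟩, rfl⟩
  obtain ⟨u', -, v', -, rfl⟩ := mem_mkTab_iff.1 he
  simp only [Prod.mk.injEq] at hk
  rw [hk.1, hk.2]

/-- Lookup in `mkTab` at an unlisted key is `0`. [folklore] -/
theorem lookup_mkTab_of_notMem {keys : List Cfg} (f : Cfg → Cfg → ZW) {u v : Cfg} (h : u ∉ keys ∨ v ∉ keys) :
    lookup (mkTab keys f) (u, v) = 0 := by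
  refine lookup_eq_zero_of_forall_ne fun e he hk => ?_
  obtain ⟨u', hu', v', hv', rfl⟩ := mem_mkTab_iff.1 he
  simp only [Prod.mk.injEq] at hk
  rcases h with h | h
  · exact h (hk.1 ▸ hu')
  · exact h (hk.2 ▸ hv')

/-- `mkTab` only depends on the values at listed keys. [folklore] -/
theorem mkTab_congr {keys : List Cfg} {f g : Cfg → Cfg → ZW} (h : ∀ u ∈ keys, ∀ v ∈ keys, f u v = g u v) :
    mkTab keys f = mkTab keys g := by
  simp only [mkTab]
  congr 1
  refine List.map_congr_left fun u hu => List.map_congr_left fun v hv => ?_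
  rw [h u hu v hv]

/-- Doubling a `mkTab` table. [folklore] -/
theorem doubleTab_mkTab (W : ℕ) (keys : List Cfg) (f : Cfg → Cfg → ZW) :
    doubleTab W (mkTab keys f) = mkTab keys fun u v => capZ W (f u v + f u v) := by
  simp [doubleTab, mkTab, List.map_flatten, List.map_map, Function.comp_def]

/-- `capZ` does nothing to small coordinates. [folklore] -/
theorem capZ_eq_self {W : ℕ} {z : ZW} (h : ∀ k, (z k).natAbs < 2 ^ W) : capZ W z = z := by
  funext k; exact if_pos (h k)

/-- `divZ (2^h)` is `ZW.divPow h`. [folklore] -/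
theorem divZ_two_pow (h : ℕ) (z : ZW) : divZ (2 ^ h) z = ZW.divPow h z := rfl

/-! ### Ideal tables -/

/-- **The ideal table of a wire set**: the integral Gram data `gramZ B c` tabulated over the
configurations supported in `B`. [cite: JozsaLinden2003, §3 (proof of lemma ratpbl, (b) block states)] -/
def tabOf (p : ℕ) (B : Finset (Fin N)) (c : QReg N → ZW) : Tab :=
  mkTab (subCfgs p (maskOf B)) fun u v => gramZ B c (toReg N u) (toReg N v)

/-- Lookup in an ideal table at configurations of `cfg B`. [folklore] -/
theorem lookup_tabOf {p : ℕ} {B : Finset (Fin N)} (hB : B.card ≤ 2 * p) (c : QReg N → ZW) {yu yv : QReg N}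
    (hu : yu ∈ cfg B) (hv : yv ∈ cfg B) : lookup (tabOf p B c) (ofReg yu, ofReg yv) = gramZ B c yu yv := by
  rw [tabOf, lookup_mkTab _ (ofReg_mem_subCfgs hB hu) (ofReg_mem_subCfgs hB hv), toReg_ofReg, toReg_ofReg]

/-- Lookup in an ideal table at the projections of arbitrary registers. [folklore] -/
theorem lookup_tabOf_proj {p : ℕ} {B : Finset (Fin N)} (hB : B.card ≤ 2 * p) (c : QReg N → ZW) (yu yv : QReg N) :
    lookup (tabOf p B c) (ofReg (proj B yu), ofReg (proj B yv)) = gramZ B c yu yv := by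
  rw [lookup_tabOf hB c (proj_mem_cfg B yu) (proj_mem_cfg B yv)]
  exact gramZ_congr (fun i hi => proj_apply_of_mem yu hi) (fun i hi => proj_apply_of_mem yv hi)

section Family

variable (F : QCircuitFamily cliffordT) (x : List Bool)

/-- **Saturation is inert on the block data** once `hExp + 2 ≤ W`. [cite: JozsaLinden2003, §3 (lemma ratlemma)] -/
theorem capZ_gramZ_ampZ (hF : F.IsOracleFree) {j W : ℕ} (hW : F.hExp x j + 2 ≤ W)
    (B : Finset (Fin (x.length + F.ancillas x.length))) (u v : QReg (x.length + F.ancillas x.length)) :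
    capZ W (gramZ B (F.ampZ x j) u v) = gramZ B (F.ampZ x j) u v := by
  refine capZ_eq_self fun k => ?_
  calc ((gramZ B (F.ampZ x j) u v) k).natAbs ≤ 2 * 2 ^ F.hExp x j := natAbs_gramZ_ampZ_le F x hF j B u v k
    _ = 2 ^ (F.hExp x j + 1) := by rw [pow_succ]; ring
    _ < 2 ^ W := Nat.pow_lt_pow_right (by norm_num) (by omega)

/-! ### Merging two blocks -/

/-- **The merge step computes the ideal table of the union.** [cite: JozsaLinden2003, §3 (proof of lemma ratpbl, Case 2: amalgamation)] -/
theorem mergeTab_tabOf (hF : F.IsOracleFree) {p j W : ℕ} (hW : F.hExp x j + 2 ≤ W)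
    {B₁ B₂ : Finset (Fin (x.length + F.ancillas x.length))} (h₁ : Splits (F.stateAfter x j) B₁) (h₁₂ : Disjoint B₁ B₂)
    (hB₁ : B₁.card ≤ 2 * p) (hB₂ : B₂.card ≤ 2 * p) (hC : (B₁ ∪ B₂).card ≤ 2 * p) :
    mergeTab W (2 ^ F.hExp x j) (maskOf B₁) (tabOf p B₁ (F.ampZ x j)) (maskOf B₂) (tabOf p B₂ (F.ampZ x j))
      (subCfgs p (maskOf (B₁ ∪ B₂))) = tabOf p (B₁ ∪ B₂) (F.ampZ x j) := by
  rw [mergeTab]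
  conv_rhs => rw [tabOf]
  refine mkTab_congr fun u hu v hv => ?_
  obtain ⟨yu, -, rfl⟩ := (mem_subCfgs_maskOf_iff hC).1 hu
  obtain ⟨yv, -, rfl⟩ := (mem_subCfgs_maskOf_iff hC).1 hv
  rw [band_ofReg_maskOf, band_ofReg_maskOf, band_ofReg_maskOf, band_ofReg_maskOf, lookup_tabOf_proj hB₁,
    lookup_tabOf_proj hB₂, divZ_two_pow, ← gramZ_union_ampZ F x hF j h₁ h₁₂, toReg_ofReg, toReg_ofReg,
    capZ_gramZ_ampZ F x hF hW]

/-! ### Untouched blocks -/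

/-- The number of the gate symbol (the `Encodable` numbering of `CliffordTOp`). [folklore] -/
def opNum : CliffordTOp → ℕ
  | .H => 0
  | .S => 1
  | .T => 2
  | .CNOT => 3

/-- **An untouched block after the gate**: doubled at a Hadamard gate, unchanged otherwise. [cite: JozsaLinden2003, §3 (proof of lemma ratpbl, Cases 1 and 2)] -/
theorem tabOf_ampZ_succ_of_disjoint (hF : F.IsOracleFree) {p j W : ℕ} (hj : j < (F.circ x.length).gates.length)
    (hW : F.hExp x (j + 1) + 2 ≤ W) {op : CliffordTOp} {e : Fin (cliffordT.arity op) ↪ Fin (x.length + F.ancillas x.length)}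
    (hg : (F.circ x.length).gates[j] = QGate.gate op e) {B : Finset (Fin (x.length + F.ancillas x.length))}
    (hB : ∀ k, e k ∉ B) :
    tabOf p B (F.ampZ x (j + 1)) =
      if opNum op = 0 then doubleTab W (tabOf p B (F.ampZ x j)) else tabOf p B (F.ampZ x j) := by
  have key : ∀ u v, gramZ B (F.ampZ x (j + 1)) u v = (2 : ℤ) ^ sqrtTwoExp op • gramZ B (F.ampZ x j) u v :=
    gramZ_ampZ_succ_of_disjoint F x hj hg hB
  split_ifs with hop
  · rw [tabOf, tabOf, doubleTab_mkTab]
    refine mkTab_congr fun u _ v _ => ?_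
    rw [← capZ_gramZ_ampZ F x hF hW, key]
    cases op <;> simp [opNum] at hop
    simp [sqrtTwoExp, two_smul]
  · rw [tabOf, tabOf]
    refine mkTab_congr fun u _ v _ => ?_
    rw [key]
    cases op <;> simp [opNum] at hop <;> simp [sqrtTwoExp]

/-! ### The gate on the merged wires -/

/-- The `k`-th wire of the gate as a natural number (`0` if the gate has fewer wires). [folklore] -/
def wireIdx (op : CliffordTOp) (e : Fin (cliffordT.arity op) ↪ Fin N) (k : ℕ) : ℕ :=
  if h : k < cliffordT.arity op then (e ⟨k, h⟩ : ℕ) else 0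

/-- A register on one wire is constant. [folklore] -/
theorem comp_fin_one {α : Type*} (f : Fin 1 → α) : f = fun _ => f 0 := by
  funext i; rw [Subsingleton.elim i 0]

/-- A register on two wires is the vector of its two values. [folklore] -/
theorem eq_vec_two {α : Type*} (f : Fin 2 → α) : f = ![f 0, f 1] := by
  funext i; fin_cases i <;> rfl

/-- Sum over `QReg 1` as a sum over the bit. [folklore] -/
theorem sum_qreg_one {M : Type*} [AddCommMonoid M] (g : QReg 1 → M) :
    ∑ z : QReg 1, g z = ∑ a : Bool, g (fun _ => a) :=
  Fintype.sum_equiv (Equiv.funUnique (Fin 1) Bool) _ _ fun z => by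
    conv_lhs => rw [comp_fin_one z]
    rfl

/-- Sum over `QReg 2` as a sum over the pair of bits. [folklore] -/
theorem sum_qreg_two {M : Type*} [AddCommMonoid M] (g : QReg 2 → M) :
    ∑ z : QReg 2, g z = ∑ a : Bool × Bool, g ![a.1, a.2] :=
  Fintype.sum_equiv (piFinTwoEquiv fun _ => Bool) _ _ fun z => by
    conv_lhs => rw [eq_vec_two z]
    rfl

/-- `sumZ` of a mapped two-element list. [folklore] -/
theorem sumZ_map_bools (g : Bool → ZW) : sumZ (bools.map g) = ∑ a : Bool, g a := by
  rw [sumZ_eq_sum, Fintype.sum_bool, add_comm]; simp [bools]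

/-- `sumZ` over the local configurations of a one-qubit gate. [folklore] -/
theorem sumZ_map_localCfgs_one {op : ℕ} (hop : op ≠ 3) (g : Bool × Bool → ZW) :
    sumZ ((localCfgs op).map g) = ∑ a : Bool, g (a, false) := by
  rw [localCfgs, if_neg hop, List.map_map, sumZ_map_bools]; rfl

/-- `sumZ` over the local configurations of `CNOT`. [folklore] -/
theorem sumZ_map_localCfgs_two (g : Bool × Bool → ZW) : sumZ ((localCfgs 3).map g) = ∑ a : Bool × Bool, g a := by
  rw [localCfgs, if_pos rfl, sumZ_eq_sum, Fintype.sum_prod_type]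
  simp only [Fintype.sum_bool, bools, List.map_cons, List.map_nil, List.flatten_cons, List.flatten_nil, List.append_nil,
    List.sum_cons, List.sum_nil, List.cons_append, List.nil_append, add_zero]
  abel

/-- `Function.extend` along a one-wire embedding is an update (the same statement as
`extend_fin_one` of `ForrelationThm25Amplitude.lean`, which is not imported here: it would pull the
Forrelation development into this file for a nine-line lemma). [folklore] -/
theorem extend_eq_update_one (e : Fin 1 ↪ Fin N) (z : QReg 1) (u : QReg N) :
    Function.extend e z u = Function.update u (e 0) (z 0) := by
  funext w
  by_cases hw : w = e 0
  · subst hw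
    rw [e.injective.extend_apply, Function.update_self]
  · rw [Function.update_of_ne hw, Function.extend_apply']
    rintro ⟨k, rfl⟩
    exact hw (by rw [Subsingleton.elim k 0])

/-- `Function.extend` along a two-wire embedding is two updates. [folklore] -/
theorem extend_eq_update_two (e : Fin 2 ↪ Fin N) (z : QReg 2) (u : QReg N) :
    Function.extend e z u = Function.update (Function.update u (e 0) (z 0)) (e 1) (z 1) := by
  funext w
  by_cases h1 : w = e 1
  · subst h1; rw [e.injective.extend_apply, Function.update_self]
  rw [Function.update_of_ne h1]
  by_cases h0 : w = e 0
  · subst h0; rw [e.injective.extend_apply, Function.update_self]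
  rw [Function.update_of_ne h0, Function.extend_apply']
  rintro ⟨k, rfl⟩
  fin_cases k
  · exact h0 rfl
  · exact h1 rfl

/-- An update at a wire of `C` stays in `cfg C`. [folklore] -/
theorem update_mem_cfg {C : Finset (Fin N)} {u : QReg N} (hu : u ∈ cfg C) {w : Fin N} (hw : w ∈ C) (b : Bool) :
    Function.update u w b ∈ cfg C := by
  rw [mem_cfg] at hu ⊢
  intro i hi
  rw [Function.update_of_ne (by rintro rfl; exact hi hw)]
  exact hu i hi

/-- The coefficients of the program are the entries of `gateZ`: `H`. [folklore] -/
theorem coef_H (x₀ x₁ y₀ y₁ : Bool) : coef 0 x₀ x₁ y₀ y₁ = gateZ .H (fun _ => x₀) (fun _ => y₀) := by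
  cases x₀ <;> cases y₀ <;> simp [coef, gateZ]

/-- The coefficients of the program are the entries of `gateZ`: `S`. [folklore] -/
theorem coef_S (x₀ x₁ y₀ y₁ : Bool) : coef 1 x₀ x₁ y₀ y₁ = gateZ .S (fun _ => x₀) (fun _ => y₀) := by
  simp only [coef, gateZ, Matrix.of_apply, one_ne_zero, if_false, if_true]
  by_cases hxy : x₀ = y₀
  · subst hxy; simp
  · rw [if_neg hxy, if_neg]
    exact fun h => hxy (congrFun h ⟨0, Nat.one_pos⟩)

/-- The coefficients of the program are the entries of `gateZ`: `T`. [folklore] -/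
theorem coef_T (x₀ x₁ y₀ y₁ : Bool) : coef 2 x₀ x₁ y₀ y₁ = gateZ .T (fun _ => x₀) (fun _ => y₀) := by
  simp only [coef, gateZ, Matrix.of_apply, show (2 : ℕ) ≠ 0 from two_ne_zero, show (2 : ℕ) ≠ 1 by decide, if_false, if_true]
  by_cases hxy : x₀ = y₀
  · subst hxy; simp
  · rw [if_neg hxy, if_neg]
    exact fun h => hxy (congrFun h ⟨0, Nat.one_pos⟩)

/-- The coefficients of the program are the entries of `gateZ`: `CNOT`. [folklore] -/
theorem coef_CNOT (x₀ x₁ y₀ y₁ : Bool) : coef 3 x₀ x₁ y₀ y₁ = gateZ .CNOT ![x₀, x₁] ![y₀, y₁] := by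
  cases x₀ <;> cases x₁ <;> cases y₀ <;> cases y₁ <;> simp [coef, gateZ]

/-- Configurations of `cfg C` glued along `S` stay in `cfg C`. [folklore] -/
theorem piecewise_mem_cfg_of_mem {S C : Finset (Fin N)} {u v : QReg N} (hu : u ∈ cfg C) (hv : v ∈ cfg C) :
    S.piecewise u v ∈ cfg C := by
  rw [mem_cfg] at hu hv ⊢
  intro i hi
  by_cases hiS : i ∈ S
  · rw [Finset.piecewise_eq_of_mem _ _ _ hiS]; exact hu i hi
  · rw [Finset.piecewise_eq_of_notMem _ _ _ hiS]; exact hv i hi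

section GateStep

variable {F x}

/-- The gate step for a one-qubit gate on wire `e₀`, given the update identity in program form. [cite: JozsaLinden2003, §3 (proof of lemma ratpbl, Cases 1 and 2)] -/
theorem gateTab_tabOf_one (hF : F.IsOracleFree) {p j W : ℕ} (hW : F.hExp x (j + 1) + 2 ≤ W)
    {C : Finset (Fin (x.length + F.ancillas x.length))} (hC : C.card ≤ 2 * p)
    {opn : ℕ} (hopn : opn ≠ 3) {e₀ : Fin (x.length + F.ancillas x.length)} (he : e₀ ∈ C) (j₂ : ℕ)
    (hsucc : ∀ (u v : QReg (x.length + F.ancillas x.length)) (x₁ y₁ : Bool), gramZ C (F.ampZ x (j + 1)) u v =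
      ∑ a : Bool, ∑ b : Bool, ZW.mul (ZW.mul (coef opn (u e₀) x₁ a false)
        (gramZ C (F.ampZ x j) (Function.update u e₀ a) (Function.update v e₀ b))) (ZW.cconj (coef opn (v e₀) y₁ b false))) :
    gateTab W opn e₀ j₂ (subCfgs p (maskOf C)) (tabOf p C (F.ampZ x j)) = tabOf p C (F.ampZ x (j + 1)) := by
  rw [gateTab]
  conv_rhs => rw [tabOf]
  refine mkTab_congr fun u hu v hv => ?_
  obtain ⟨yu, hyu, rfl⟩ := (mem_subCfgs_maskOf_iff hC).1 hu
  obtain ⟨yv, hyv, rfl⟩ := (mem_subCfgs_maskOf_iff hC).1 hv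
  rw [toReg_ofReg, toReg_ofReg, ← capZ_gramZ_ampZ F x hF hW C yu yv,
    hsucc yu yv ((ofReg yu).getD j₂ false) ((ofReg yv).getD j₂ false)]
  congr 1
  have hl : ∀ a b : Bool, lookup (tabOf p C (F.ampZ x j)) (ofReg (Function.update yu e₀ a), ofReg (Function.update yv e₀ b)) =
      gramZ C (F.ampZ x j) (Function.update yu e₀ a) (Function.update yv e₀ b) := fun a b =>
    lookup_tabOf hC _ (update_mem_cfg hyu he _) (update_mem_cfg hyv he _)
  simp only [gateEntry, sumZ_map_localCfgs_one hopn, setLocal, if_neg hopn, getD_ofReg_fin, setAt_ofReg, hl]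

/-- The gate step for `CNOT` on wires `e₀, e₁`, given the update identity in program form. [cite: JozsaLinden2003, §3 (proof of lemma ratpbl, Cases 1 and 2)] -/
theorem gateTab_tabOf_two (hF : F.IsOracleFree) {p j W : ℕ} (hW : F.hExp x (j + 1) + 2 ≤ W)
    {C : Finset (Fin (x.length + F.ancillas x.length))} (hC : C.card ≤ 2 * p)
    {e₀ e₁ : Fin (x.length + F.ancillas x.length)} (he0 : e₀ ∈ C) (he1 : e₁ ∈ C)
    (hsucc : ∀ u v : QReg (x.length + F.ancillas x.length), gramZ C (F.ampZ x (j + 1)) u v =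
      ∑ a : Bool × Bool, ∑ b : Bool × Bool, ZW.mul (ZW.mul (coef 3 (u e₀) (u e₁) a.1 a.2)
        (gramZ C (F.ampZ x j) (Function.update (Function.update u e₀ a.1) e₁ a.2)
          (Function.update (Function.update v e₀ b.1) e₁ b.2)))
        (ZW.cconj (coef 3 (v e₀) (v e₁) b.1 b.2))) :
    gateTab W 3 e₀ e₁ (subCfgs p (maskOf C)) (tabOf p C (F.ampZ x j)) = tabOf p C (F.ampZ x (j + 1)) := by
  rw [gateTab]
  conv_rhs => rw [tabOf]
  refine mkTab_congr fun u hu v hv => ?_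
  obtain ⟨yu, hyu, rfl⟩ := (mem_subCfgs_maskOf_iff hC).1 hu
  obtain ⟨yv, hyv, rfl⟩ := (mem_subCfgs_maskOf_iff hC).1 hv
  rw [toReg_ofReg, toReg_ofReg, ← capZ_gramZ_ampZ F x hF hW C yu yv, hsucc yu yv]
  congr 1
  have hl : ∀ a b : Bool × Bool, lookup (tabOf p C (F.ampZ x j))
      (ofReg (Function.update (Function.update yu e₀ a.1) e₁ a.2), ofReg (Function.update (Function.update yv e₀ b.1) e₁ b.2)) =
      gramZ C (F.ampZ x j) (Function.update (Function.update yu e₀ a.1) e₁ a.2)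
        (Function.update (Function.update yv e₀ b.1) e₁ b.2) := fun a b =>
    lookup_tabOf hC _ (update_mem_cfg (update_mem_cfg hyu he0 _) he1 _) (update_mem_cfg (update_mem_cfg hyv he0 _) he1 _)
  simp only [gateEntry, sumZ_map_localCfgs_two, setLocal, if_true, getD_ofReg_fin, setAt_ofReg, hl]

end GateStep

/-- **The gate step computes the ideal table of the new state on the merged wires.** [cite: JozsaLinden2003, §3 (proof of lemma ratpbl, Cases 1 and 2: "applying a unitary matrix of size at most 2^{2p} × 2^{2p}")] -/
theorem gateTab_tabOf (hF : F.IsOracleFree) {p j W : ℕ} (hj : j < (F.circ x.length).gates.length)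
    (hW : F.hExp x (j + 1) + 2 ≤ W) {op : CliffordTOp} {e : Fin (cliffordT.arity op) ↪ Fin (x.length + F.ancillas x.length)}
    (hg : (F.circ x.length).gates[j] = QGate.gate op e) {C : Finset (Fin (x.length + F.ancillas x.length))}
    (hCe : ∀ k, e k ∈ C) (hC : C.card ≤ 2 * p) :
    gateTab W (opNum op) (wireIdx op e 0) (wireIdx op e 1) (subCfgs p (maskOf C)) (tabOf p C (F.ampZ x j)) =
      tabOf p C (F.ampZ x (j + 1)) := by
  have hsucc := gramZ_ampZ_succ_of_subset F x hj hg hCe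
  cases op with
  | H =>
    let i₀ : Fin (cliffordT.arity .H) := ⟨0, Nat.one_pos⟩
    have hs : ∀ g : QReg (cliffordT.arity .H) → ZW, ∑ z, g z = ∑ a : Bool, g (fun _ => a) := fun g => sum_qreg_one g
    have hx : ∀ (z : QReg (cliffordT.arity .H)) (w : QReg (x.length + F.ancillas x.length)),
        Function.extend e z w = Function.update w (e i₀) (z i₀) := fun z w => extend_eq_update_one e z w
    have hc : ∀ w : QReg (x.length + F.ancillas x.length), (w ∘ e : QReg (cliffordT.arity .H)) = fun _ => w (e i₀) :=
      fun w => comp_fin_one (w ∘ e)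
    have h0 : wireIdx .H e 0 = ((e i₀ : Fin _) : ℕ) := by simp [wireIdx, i₀]; rfl
    rw [h0]
    refine gateTab_tabOf_one hF hW hC (by decide) (hCe i₀) _ fun u v x₁ y₁ => ?_
    rw [hsucc, hs]
    simp only [hs, hx, hc, coef_H, opNum]
  | S =>
    let i₀ : Fin (cliffordT.arity .S) := ⟨0, Nat.one_pos⟩
    have hs : ∀ g : QReg (cliffordT.arity .S) → ZW, ∑ z, g z = ∑ a : Bool, g (fun _ => a) := fun g => sum_qreg_one g
    have hx : ∀ (z : QReg (cliffordT.arity .S)) (w : QReg (x.length + F.ancillas x.length)),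
        Function.extend e z w = Function.update w (e i₀) (z i₀) := fun z w => extend_eq_update_one e z w
    have hc : ∀ w : QReg (x.length + F.ancillas x.length), (w ∘ e : QReg (cliffordT.arity .S)) = fun _ => w (e i₀) :=
      fun w => comp_fin_one (w ∘ e)
    have h0 : wireIdx .S e 0 = ((e i₀ : Fin _) : ℕ) := by simp [wireIdx, i₀]; rfl
    rw [h0]
    refine gateTab_tabOf_one hF hW hC (by decide) (hCe i₀) _ fun u v x₁ y₁ => ?_
    rw [hsucc, hs]
    simp only [hs, hx, hc, coef_S, opNum]
  | T =>
    let i₀ : Fin (cliffordT.arity .T) := ⟨0, Nat.one_pos⟩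
    have hs : ∀ g : QReg (cliffordT.arity .T) → ZW, ∑ z, g z = ∑ a : Bool, g (fun _ => a) := fun g => sum_qreg_one g
    have hx : ∀ (z : QReg (cliffordT.arity .T)) (w : QReg (x.length + F.ancillas x.length)),
        Function.extend e z w = Function.update w (e i₀) (z i₀) := fun z w => extend_eq_update_one e z w
    have hc : ∀ w : QReg (x.length + F.ancillas x.length), (w ∘ e : QReg (cliffordT.arity .T)) = fun _ => w (e i₀) :=
      fun w => comp_fin_one (w ∘ e)
    have h0 : wireIdx .T e 0 = ((e i₀ : Fin _) : ℕ) := by simp [wireIdx, i₀]; rfl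
    rw [h0]
    refine gateTab_tabOf_one hF hW hC (by decide) (hCe i₀) _ fun u v x₁ y₁ => ?_
    rw [hsucc, hs]
    simp only [hs, hx, hc, coef_T, opNum]
  | CNOT =>
    let i₀ : Fin (cliffordT.arity .CNOT) := ⟨0, by decide⟩
    let i₁ : Fin (cliffordT.arity .CNOT) := ⟨1, by decide⟩
    have hs : ∀ g : QReg (cliffordT.arity .CNOT) → ZW, ∑ z, g z = ∑ a : Bool × Bool, g ![a.1, a.2] :=
      fun g => sum_qreg_two g
    have hx : ∀ (z : QReg (cliffordT.arity .CNOT)) (w : QReg (x.length + F.ancillas x.length)),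
        Function.extend e z w = Function.update (Function.update w (e i₀) (z i₀)) (e i₁) (z i₁) :=
      fun z w => extend_eq_update_two e z w
    have hc : ∀ w : QReg (x.length + F.ancillas x.length), (w ∘ e : QReg (cliffordT.arity .CNOT)) = ![w (e i₀), w (e i₁)] :=
      fun w => eq_vec_two (w ∘ e)
    have hv0 : ∀ a b : Bool, (![a, b] : QReg (cliffordT.arity .CNOT)) i₀ = a := fun _ _ => rfl
    have hv1 : ∀ a b : Bool, (![a, b] : QReg (cliffordT.arity .CNOT)) i₁ = b := fun _ _ => rfl
    have h0 : wireIdx .CNOT e 0 = ((e i₀ : Fin _) : ℕ) := by simp [wireIdx, i₀]; rfl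
    have h1 : wireIdx .CNOT e 1 = ((e i₁ : Fin _) : ℕ) := by simp [wireIdx, i₁]; rfl
    rw [h0, h1]
    refine gateTab_tabOf_two hF hW hC (hCe i₀) (hCe i₁) fun u v => ?_
    rw [hsucc, hs]
    simp only [hs, hx, hc, hv0, hv1, coef_CNOT]

/-! ### The column, the split test and the partial trace -/

/-- The first-hit fold behind `firstNonzeroDiag`. [folklore] -/
theorem foldl_firstHit {α : Type} (P : α → Prop) [DecidablePred P] (l : List α) (d : α) :
    (l.foldl (fun acc u => if acc.1 then acc else if ¬P u then acc else (true, u)) (false, d)) =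
      match l.find? (fun u => decide (P u)) with | some u => (true, u) | none => (false, d) := by
  suffices h : ∀ (l : List α) (acc : Bool × α), acc.1 = true →
      l.foldl (fun acc u => if acc.1 then acc else if ¬P u then acc else (true, u)) acc = acc by
    induction l with
    | nil => rfl
    | cons a l ih =>
      rw [List.foldl_cons, List.find?_cons]
      by_cases ha : P a
      · simp only [Bool.false_eq_true, if_false, ha, not_true_eq_false, decide_true]
        exact h l _ rfl
      · simp only [Bool.false_eq_true, if_false, ha, not_false_eq_true, if_true, decide_false]
        exact ih
  intro l
  induction l with
  | nil => intro acc _; rfl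
  | cons a l ih => intro acc hacc; rw [List.foldl_cons, if_pos hacc]; exact ih acc hacc

/-- **The column index**: on an ideal table, `firstNonzeroDiag` returns a configuration of `cfg C`
with nonzero diagonal Gram entry. [cite: JozsaLinden2003, §3 (proof of lemma ratpbl, Case 2)] -/
theorem firstNonzeroDiag_tabOf (hF : F.IsOracleFree) {p : ℕ} (j : ℕ)
    {C : Finset (Fin (x.length + F.ancillas x.length))} (hC : C.card ≤ 2 * p) :
    ∃ y₀ ∈ cfg C, firstNonzeroDiag (x.length + F.ancillas x.length) (subCfgs p (maskOf C)) (tabOf p C (F.ampZ x j)) = ofReg y₀ ∧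
      gramZ C (F.ampZ x j) y₀ y₀ ≠ 0 := by
  have hfold := foldl_firstHit (fun u => lookup (tabOf p C (F.ampZ x j)) (u, u) ≠ 0) (subCfgs p (maskOf C))
    (zeros (x.length + F.ancillas x.length))
  simp only [not_not] at hfold
  rw [firstNonzeroDiag, hfold]
  obtain ⟨y, hy, hy0⟩ := exists_gramZ_self_ne_zero F x hF j C
  cases hfind : (subCfgs p (maskOf C)).find? (fun u => decide (lookup (tabOf p C (F.ampZ x j)) (u, u) ≠ 0)) with
  | none =>
    exfalso
    have := List.find?_eq_none.1 hfind (ofReg y) (ofReg_mem_subCfgs hC hy)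
    rw [lookup_tabOf hC _ hy hy] at this
    simp [hy0] at this
  | some u =>
    have hu := List.mem_of_find?_eq_some hfind
    have hPu := List.find?_some hfind
    obtain ⟨y₀, hy₀, rfl⟩ := (mem_subCfgs_maskOf_iff hC).1 hu
    refine ⟨y₀, hy₀, rfl, ?_⟩
    rw [lookup_tabOf hC _ hy₀ hy₀] at hPu
    simpa using hPu

/-- **The split test on an ideal table is the `Splits` predicate** for sub-masks of `C`. [cite: JozsaLinden2003, §3 (proof of lemma ratpbl, Case 2: "looking for an equality of states")] -/
theorem splitsTest_tabOf (hF : F.IsOracleFree) {p j : ℕ} {C : Finset (Fin (x.length + F.ancillas x.length))}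
    (hCs : Splits (F.stateAfter x j) C) (hC : C.card ≤ 2 * p) {y₀ : QReg (x.length + F.ancillas x.length)}
    (hy₀C : y₀ ∈ cfg C) (hy₀ : gramZ C (F.ampZ x j) y₀ y₀ ≠ 0) {S : Finset (Fin (x.length + F.ancillas x.length))}
    (hS : S ⊆ C) :
    splitsTest (subCfgs p (maskOf C)) (tabOf p C (F.ampZ x j)) (ofReg y₀) (maskOf S) = true ↔
      Splits (F.stateAfter x j) S := by
  rw [splits_stateAfter_iff_columnZ F x hF hCs hy₀ hS, columnZ_test_iff_cfg hS, splitsTest]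
  simp only [List.all_eq_true, decide_eq_true_eq]
  constructor
  · intro h u hu v hv
    have := h (ofReg u) (ofReg_mem_subCfgs hC hu) (ofReg v) (ofReg_mem_subCfgs hC hv)
    rwa [pw_maskOf, pw_maskOf, lookup_tabOf hC _ hu hy₀C, lookup_tabOf hC _ hv hy₀C,
      lookup_tabOf hC _ (piecewise_mem_cfg_of_mem hu hv) hy₀C, lookup_tabOf hC _ (piecewise_mem_cfg_of_mem hv hu) hy₀C] at this
  · intro h u hu v hv
    obtain ⟨yu, hyu, rfl⟩ := (mem_subCfgs_maskOf_iff hC).1 hu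
    obtain ⟨yv, hyv, rfl⟩ := (mem_subCfgs_maskOf_iff hC).1 hv
    rw [pw_maskOf, pw_maskOf, lookup_tabOf hC _ hyu hy₀C, lookup_tabOf hC _ hyv hy₀C,
      lookup_tabOf hC _ (piecewise_mem_cfg_of_mem hyu hyv) hy₀C, lookup_tabOf hC _ (piecewise_mem_cfg_of_mem hyv hyu) hy₀C]
    exact h yu hyu yv hyv

/-- Gluing a configuration of `A` with one of `C ∖ A` by `bor`. [folklore] -/
theorem bor_ofReg_of_mem_cfg {A C : Finset (Fin N)} {yu t : QReg N} (hyu : yu ∈ cfg A) (ht : t ∈ cfg (C \ A)) :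
    bor (ofReg yu) (ofReg t) = ofReg ((C \ A).piecewise t yu) := by
  rw [bor_ofReg]; congr 1; funext i
  rw [mem_cfg] at hyu ht
  by_cases hi : i ∈ C \ A
  · rw [Finset.piecewise_eq_of_mem _ _ _ hi, hyu i (Finset.mem_sdiff.1 hi).2, Bool.false_or]
  · rw [Finset.piecewise_eq_of_notMem _ _ _ hi, ht i hi, Bool.or_false]

/-- A glued configuration lies in `cfg C`. [folklore] -/
theorem piecewise_sdiff_mem_cfg {A C : Finset (Fin N)} (hAC : A ⊆ C) {yu : QReg N} (hyu : yu ∈ cfg A) (t : QReg N) :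
    (C \ A).piecewise t yu ∈ cfg C := by
  rw [mem_cfg] at hyu ⊢
  intro i hi
  rw [Finset.piecewise_eq_of_notMem _ _ _ (fun h => hi (Finset.mem_sdiff.1 h).1)]
  exact hyu i fun h => hi (hAC h)

/-- **The partial-trace step computes the Gram data of a sub-block.** [cite: JozsaLinden2003, §3 (proof of lemma ratpbl, Case 2: "compute the reduced state ρ_X of every subset")] -/
theorem capZ_traceEntry_tabOf (hF : F.IsOracleFree) {p j W : ℕ} (hW : F.hExp x j + 2 ≤ W)
    {A C : Finset (Fin (x.length + F.ancillas x.length))} (hAC : A ⊆ C) (hC : C.card ≤ 2 * p)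
    {yu yv : QReg (x.length + F.ancillas x.length)} (hyu : yu ∈ cfg A) (hyv : yv ∈ cfg A) :
    capZ W (traceEntry p (maskOf C) (maskOf A) (tabOf p C (F.ampZ x j)) (ofReg yu) (ofReg yv)) = gramZ A (F.ampZ x j) yu yv := by
  have hCA : (C \ A).card ≤ 2 * p := (card_le_card sdiff_subset).trans hC
  rw [traceEntry, bandnot_maskOf, sumZ_eq_sum, sum_map_subCfgs_maskOf hCA,
    sum_congr rfl fun t ht => by
      rw [bor_ofReg_of_mem_cfg hyu ht, bor_ofReg_of_mem_cfg hyv ht,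
        lookup_tabOf hC _ (piecewise_sdiff_mem_cfg hAC hyu t) (piecewise_sdiff_mem_cfg hAC hyv t)],
    ← gramZ_eq_sum_gramZ hAC, capZ_gramZ_ampZ F x hF hW A yu yv]

end Family

end PSim

end Literature.Barriers.QuantumAdvantage

end
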